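import Summits.ABC.StewartYu.GenThreeReduceArch
import HarnessLib

/-!
# Cell abc-stewartyu, WP-L.A shell (parcel P-A1): MATVEEV'S INDUCTION at the archimedean place in the
# PIVOT-WEIGHTED currency (Matveev 2000 (1.3): `B ≥ maxₖ |bₖ|Aₖ/A_{k₀}`) — the internal statement `CoreArchW`,
# its step data and dichotomy, the strong induction, and the unweighted crux text from it

`Summits/ABC/StewartYu/GenThreeInductionArchW.lean` — cell `abc-stewartyu` (HOME `run/shared/lean/pub/abc-stewartyu/`),
route `YuMatveevShapeRat` (rung A1.L, crux r2 `ArchCoreRat`, stmt-ABC-20502), seat p4 (g9), parcel WP-L.A P-A1.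
Theorems and three plain `Prop`-valued definitions; no named fact, no analytic content.

## Why a second currency (lit WP-LA-SPEC §17, 2026-08-27; p4 STATUS 16:1xZ)

`GenThreeInductionArch.CoreArch C r` (the crux text at the constant function `C`, UNWEIGHTED: `|bᵢ| ≤ B`) is the
right TARGET but the wrong INDUCTION HYPOTHESIS: in Matveev's step the new coefficients satisfy only the WEIGHTED
Cramer–Hadamard bound `|mⱼ|·‖Zⱼ‖_A·∏A_κ′ ≤ (∑_{κ′} Aₖ|bₖ|)·∏ᵢ‖Zᵢ‖_A` (Nesterenko 2003, (2.12) as corrected;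
the tree's `MatveevStepData.exists_matveev_step_data`), so an unweighted `B′` carries `∏‖Zᵢ‖_A ~ ε·Ω`, and the
cost `C(r)·∏A′·log(eB′)` acquires a `log Ω` that no record can pay on all data (`Ω/B` is unbounded; the
working regime (2.6) bounds only `Ω/A_{k₀}`).  Print's «`B′ ≤ B²`» (p. 58) uses the uncorrected (2.12).  The
repair is Matveev's own currency (Izv. Math. 64 (2000), (1.3); tree `matveev2000_thm22_nf`:
`1 ≤ B → ∀ k, |b k|·A k/A k₀ ≤ B`): a DISTINGUISHED INDEX `k₀` (the frame's pivot, `b k₀ ≠ 0`) and the weighted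
size hypothesis `∀ i, |bᵢ|·Aᵢ ≤ B·A_{k₀}`.  In this currency the step closes with `B′ := r·B·∏A′/A′_{i₀}`,
`|m₀| ≤ ∏A′/A_{k₀}` and a purely numeric record clause (`GenThreeStepArchW.stepArchW_of_exitC`), and the
unweighted crux text follows (`archCoreRat_of_coreW`: restrict to the support of `b`, take `k₀ := argmax A`).

## Contents

`CoreArchW C r` (internal statement: positive independent rationals, `h(aᵢ) ≤ Aᵢ`, `1 ≤ Aᵢ`, pivot `b k₀ ≠ 0`,
`∀ i, |bᵢ|·Aᵢ ≤ B·A k₀` ⟹ `−C(r)·∏Aᵢ·log(eB) ≤ log |∑ bᵢ log aᵢ|`), `StepArchW` (rank-`r` datum WITH its pivot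
`i₀`, comparison `log|Λ′| − D ≤ log|Λ|`, cost `C(r)·∏A′·log(eB′) + D ≤ C(n)·∏A·log(eB)`), `DichotomyArchW`,
`core_of_dichotomyW` (strong induction, verbatim), `dichotomyArchW_of_not_le`, the currency lemmas
`abs_pivot_le_boundW` / `one_le_boundW` / `abs_le_boundW_mul_weight` / `sum_weight_abs_le_W`
(`|b k₀| ≤ B`, `1 ≤ B`, `|bᵢ| ≤ B·A k₀`, `∑ Aⱼ|bⱼ| ≤ n·B·A k₀`), `stepArchW_of_pow_eq` (the step from the
algebraic relation `∏θᵐ = (∏aᵇ)^{m₀}`, `D := log|m₀|`), `coreArchW_mono`, `coreArch_of_coreW` (UNWEIGHTED internal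
statement at every rank from the weighted one, `C` monotone: zero coefficients are deleted by
`GenThreeReduceArch.stepArch_of_exists_eq_zero`, then `k₀ := argmax A`), `archCoreRat_of_coreW` (the crux text).

WHAT THIS IS NOT: no analytic content; no crux-text change (`ArchCoreRat` is implied); no crux moves.

References: E. M. Matveev, *An explicit lower bound for a homogeneous rational linear form in logarithms of
algebraic numbers II*, Izv. Math. 64 (2000) 1217–1269, (1.3), Thm 2.1/2.2 (p. 127 of the Russian original);
Yu. V. Nesterenko, LNM 1819 (2003), Thm 2.2 (p. 55), Prop. 2.6 (2.9)–(2.13) (pp. 57–58).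
-/

noncomputable section

open Finset

namespace Summit.ABC.StewartYu.GenThreeInductionArchW

open Summit.ABC.StewartYu.GenThreeInductionArch
open Summit.ABC.StewartYu.GenThreeReduceArch (stepArch_of_exists_eq_zero)

/-! ### The pivot-weighted internal statement, step data and dichotomy -/

/-- **The internal induction statement of the archimedean Gen-3 engine at rank `r`, PIVOT-WEIGHTED currency**:
positive rationals `aᵢ`, multiplicatively independent, weights `h(aᵢ) ≤ Aᵢ`, `1 ≤ Aᵢ`, a pivot `k₀` with
`b k₀ ≠ 0`, and `|bᵢ|·Aᵢ ≤ B·A_{k₀}` for all `i` (Matveev's `B ≥ max |bₖ|Aₖ/A_{k₀}`; at `i = k₀` it gives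
`|b k₀| ≤ B`, hence `1 ≤ B`) ⟹ `−C(r)·∏Aᵢ·log(eB) ≤ log |∑ bᵢ log aᵢ|`.
[cite: Matveev2000, (1.3) and Thm 2.1 (p. 127); shape only] -/
def CoreArchW (C : ℕ → ℝ) (r : ℕ) : Prop :=
  ∀ (a : Fin r → ℚ) (b : Fin r → ℤ) (A : Fin r → ℝ) (B : ℝ) (k₀ : Fin r),
    (∀ i, 0 < a i) →
    (∀ μ : Fin r → ℤ, ∏ i, a i ^ μ i = 1 → μ = 0) →
    (∀ i, Height.logHeight₁ (a i) ≤ A i) → (∀ i, 1 ≤ A i) →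
    b k₀ ≠ 0 → (∀ i, (|b i| : ℝ) * A i ≤ B * A k₀) →
    -(C r * (∏ i, A i) * Real.log (Real.exp 1 * B)) ≤
      Real.log |∑ i, (b i : ℝ) * Real.log (a i : ℝ)|

/-- **The data of one Matveev step at rank `n`, pivot-weighted currency**: a rank `r < n`, positive rational
generators `θᵢ`, exponents `m` with a pivot `i₀` (`m i₀ ≠ 0`), weights `A′`, a bound `B′` with
`|mᵢ|·A′ᵢ ≤ B′·A′_{i₀}`, an index cost `D`, the comparison `log|∑ mᵢ log θᵢ| − D ≤ log|∑ bⱼ log aⱼ|` and the cost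
inequality `C(r)·∏A′·log(eB′) + D ≤ C(n)·∏A·log(eB)`. [cite: Nesterenko2003, Prop 2.6 (2.9)–(2.13) (pp. 57–58)] -/
def StepArchW (C : ℕ → ℝ) (n : ℕ) (a : Fin n → ℚ) (b : Fin n → ℤ) (A : Fin n → ℝ) (B : ℝ) : Prop :=
  ∃ (r : ℕ) (θ : Fin r → ℚ) (m : Fin r → ℤ) (A' : Fin r → ℝ) (B' : ℝ) (i₀ : Fin r) (D : ℝ), r < n ∧
    (∀ i, 0 < θ i) ∧
    (∀ μ : Fin r → ℤ, ∏ i, θ i ^ μ i = 1 → μ = 0) ∧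
    (∀ i, Height.logHeight₁ (θ i) ≤ A' i) ∧ (∀ i, 1 ≤ A' i) ∧
    m i₀ ≠ 0 ∧ (∀ i, (|m i| : ℝ) * A' i ≤ B' * A' i₀) ∧
    Real.log |∑ i, (m i : ℝ) * Real.log (θ i : ℝ)| - D ≤
      Real.log |∑ j, (b j : ℝ) * Real.log (a j : ℝ)| ∧
    C r * (∏ i, A' i) * Real.log (Real.exp 1 * B') + D ≤
      C n * (∏ j, A j) * Real.log (Real.exp 1 * B)

/-- **The per-rank dichotomy, pivot-weighted currency**: for every rank-`n` datum of `CoreArchW` the bound holds or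
a Matveev step exists. [cite: Nesterenko2003, Prop 2.6] -/
def DichotomyArchW (C : ℕ → ℝ) (n : ℕ) : Prop :=
  ∀ (a : Fin n → ℚ) (b : Fin n → ℤ) (A : Fin n → ℝ) (B : ℝ) (k₀ : Fin n),
    (∀ j, 0 < a j) →
    (∀ μ : Fin n → ℤ, ∏ j, a j ^ μ j = 1 → μ = 0) →
    (∀ j, Height.logHeight₁ (a j) ≤ A j) → (∀ j, 1 ≤ A j) →
    b k₀ ≠ 0 → (∀ j, (|b j| : ℝ) * A j ≤ B * A k₀) →
    -(C n * (∏ j, A j) * Real.log (Real.exp 1 * B)) ≤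
        Real.log |∑ j, (b j : ℝ) * Real.log (a j : ℝ)| ∨
      StepArchW C n a b A B

/-! ### The induction -/

/-- **Matveev's induction on the number of logarithms, pivot-weighted currency**: the per-rank dichotomy for
every rank gives the internal statement for every rank. [cite: Nesterenko2003, Thm 2.2 from Prop 2.6] -/
theorem core_of_dichotomyW {C : ℕ → ℝ} (hD : ∀ n, DichotomyArchW C n) : ∀ r, CoreArchW C r := by
  intro r
  induction r using Nat.strong_induction_on with
  | _ n ih =>
    intro a b A B k₀ ha hind hA hA1 hk₀ hBw
    rcases hD n a b A B k₀ ha hind hA hA1 hk₀ hBw with hle | hstep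
    · exact hle
    · obtain ⟨r, θ, m, A', B', i₀, D, hr, hθ, hindθ, hA', hA1', hm, hB', hcmp, hcost⟩ := hstep
      have hIH := ih r hr θ m A' B' i₀ hθ hindθ hA' hA1' hm hB'
      linarith

/-- The frame's working form of the pivot-weighted dichotomy: ASSUME the negated bound and produce the step.
[cite: Nesterenko2003, (2.14) p. 58] -/
theorem dichotomyArchW_of_not_le {C : ℕ → ℝ} {n : ℕ}
    (h : ∀ (a : Fin n → ℚ) (b : Fin n → ℤ) (A : Fin n → ℝ) (B : ℝ) (k₀ : Fin n),
      (∀ j, 0 < a j) →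
      (∀ μ : Fin n → ℤ, ∏ j, a j ^ μ j = 1 → μ = 0) →
      (∀ j, Height.logHeight₁ (a j) ≤ A j) → (∀ j, 1 ≤ A j) →
      b k₀ ≠ 0 → (∀ j, (|b j| : ℝ) * A j ≤ B * A k₀) →
      ¬ -(C n * (∏ j, A j) * Real.log (Real.exp 1 * B)) ≤
          Real.log |∑ j, (b j : ℝ) * Real.log (a j : ℝ)| →
      StepArchW C n a b A B) :
    DichotomyArchW C n := by
  intro a b A B k₀ ha hind hA hA1 hk₀ hBw
  by_cases hle : -(C n * (∏ j, A j) * Real.log (Real.exp 1 * B)) ≤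
      Real.log |∑ j, (b j : ℝ) * Real.log (a j : ℝ)|
  · exact Or.inl hle
  · exact Or.inr (h a b A B k₀ ha hind hA hA1 hk₀ hBw hle)

/-! ### Currency lemmas -/

/-- At the pivot the weighted hypothesis is `|b k₀| ≤ B`. [cite: Matveev2000, (1.3)] -/
theorem abs_pivot_le_boundW {n : ℕ} {b : Fin n → ℤ} {A : Fin n → ℝ} {B : ℝ} {k₀ : Fin n}
    (hA1 : ∀ j, 1 ≤ A j) (hBw : ∀ j, (|b j| : ℝ) * A j ≤ B * A k₀) : (|b k₀| : ℝ) ≤ B :=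
  le_of_mul_le_mul_right (hBw k₀) (by linarith [hA1 k₀])

/-- `b k₀ ≠ 0` and the weighted hypothesis force `1 ≤ B`. [cite: Matveev2000, (1.3) (`B ≥ 1`)] -/
theorem one_le_boundW {n : ℕ} {b : Fin n → ℤ} {A : Fin n → ℝ} {B : ℝ} {k₀ : Fin n}
    (hA1 : ∀ j, 1 ≤ A j) (hk₀ : b k₀ ≠ 0) (hBw : ∀ j, (|b j| : ℝ) * A j ≤ B * A k₀) : 1 ≤ B :=
  le_trans (by exact_mod_cast Int.one_le_abs hk₀) (abs_pivot_le_boundW hA1 hBw)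

/-- Each coefficient is at most `B·A_{k₀}` (the weights are `≥ 1`). [folklore] -/
theorem abs_le_boundW_mul_weight {n : ℕ} {b : Fin n → ℤ} {A : Fin n → ℝ} {B : ℝ} {k₀ : Fin n}
    (hA1 : ∀ j, 1 ≤ A j) (hBw : ∀ j, (|b j| : ℝ) * A j ≤ B * A k₀) (j : Fin n) :
    (|b j| : ℝ) ≤ B * A k₀ :=
  calc (|b j| : ℝ) = (|b j| : ℝ) * 1 := (mul_one _).symm
    _ ≤ (|b j| : ℝ) * A j := mul_le_mul_of_nonneg_left (hA1 j) (abs_nonneg _)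
    _ ≤ B * A k₀ := hBw j

/-- **The weighted size of the whole coefficient vector**: `∑ Aⱼ|bⱼ| ≤ n·B·A_{k₀}`. [cite: Matveev2000, (1.3)] -/
theorem sum_weight_abs_le_W {n : ℕ} {b : Fin n → ℤ} {A : Fin n → ℝ} {B : ℝ} {k₀ : Fin n}
    (hBw : ∀ j, (|b j| : ℝ) * A j ≤ B * A k₀) : ∑ j, A j * |(b j : ℝ)| ≤ n * B * A k₀ := by
  calc ∑ j, A j * |(b j : ℝ)| = ∑ j, (|(b j : ℝ)|) * A j := Finset.sum_congr rfl fun j _ => mul_comm _ _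
    _ ≤ ∑ _j : Fin n, B * A k₀ := Finset.sum_le_sum fun j _ => hBw j
    _ = n * B * A k₀ := by rw [Finset.sum_const, Finset.card_univ, Fintype.card_fin, nsmul_eq_mul, mul_assoc]

/-! ### The step from the algebraic relation -/

/-- **The pivot-weighted step from the algebraic relation**: rank-`r` data (`r < n`) satisfying the hypotheses of
`CoreArchW C r` (pivot `i₀`), the relation `∏ θᵐ = (∏ aᵇ)^{m₀}` (`m₀ ≠ 0`, whence `Λ′ = m₀Λ`) and the cost
inequality with the index cost `log|m₀|` give `StepArchW`. [cite: Nesterenko2003, Prop 2.6 (2.9)–(2.13)] -/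
theorem stepArchW_of_pow_eq {C : ℕ → ℝ} {n : ℕ} {a : Fin n → ℚ} {b : Fin n → ℤ} {A : Fin n → ℝ} {B : ℝ}
    (ha : ∀ j, 0 < a j) {r : ℕ} (hr : r < n) (θ : Fin r → ℚ) (m : Fin r → ℤ) (A' : Fin r → ℝ) (B' : ℝ) (i₀ : Fin r)
    (hθ : ∀ i, 0 < θ i) (hindθ : ∀ μ : Fin r → ℤ, ∏ i, θ i ^ μ i = 1 → μ = 0)
    (hA' : ∀ i, Height.logHeight₁ (θ i) ≤ A' i) (hA1' : ∀ i, 1 ≤ A' i)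
    (hm : m i₀ ≠ 0) (hB' : ∀ i, (|m i| : ℝ) * A' i ≤ B' * A' i₀)
    (m₀ : ℤ) (hm₀ : m₀ ≠ 0) (hrel : ∏ i, θ i ^ m i = (∏ j, a j ^ b j) ^ m₀)
    (hcost : C r * (∏ i, A' i) * Real.log (Real.exp 1 * B') + Real.log |(m₀ : ℝ)| ≤
      C n * (∏ j, A j) * Real.log (Real.exp 1 * B)) :
    StepArchW C n a b A B :=
  ⟨r, θ, m, A', B', i₀, Real.log |(m₀ : ℝ)|, hr, hθ, hindθ, hA', hA1', hm, hB',
    log_abs_sub_log_abs_le_of_pow_eq a ha b θ hθ m m₀ hm₀ hrel, hcost⟩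

/-! ### Monotonicity in the constant -/

/-- `C r ≤ C′ r ⇒ CoreArchW C r → CoreArchW C′ r`. [folklore] -/
theorem coreArchW_mono {C C' : ℕ → ℝ} {r : ℕ} (hCC' : C r ≤ C' r) (h : CoreArchW C r) : CoreArchW C' r := by
  intro a b A B k₀ ha hind hA hA1 hk₀ hBw
  have hcore := h a b A B k₀ ha hind hA hA1 hk₀ hBw
  have hprod : 0 ≤ ∏ i, A i := zero_le_one.trans (one_le_prod_weights hA1)
  have hlog : 0 ≤ Real.log (Real.exp 1 * B) :=
    zero_le_one.trans (one_le_log_exp_one_mul (one_le_boundW hA1 hk₀ hBw))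
  have hle : C r * (∏ i, A i) * Real.log (Real.exp 1 * B) ≤
      C' r * (∏ i, A i) * Real.log (Real.exp 1 * B) :=
    mul_le_mul_of_nonneg_right (mul_le_mul_of_nonneg_right hCC' hprod) hlog
  linarith

/-! ### The unweighted internal statement and the crux text from the weighted one -/

/-- **UNWEIGHTED from WEIGHTED**: for a monotone non-negative `C`, `CoreArchW C` at every rank gives the crux-text
internal statement `CoreArch C` at every rank (strong induction: if some `bₖ = 0` delete it — a `StepArch` by
`GenThreeReduceArch.stepArch_of_exists_eq_zero` — and use the smaller rank; otherwise take the pivot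
`k₀ := argmax A`, for which `|bᵢ|·Aᵢ ≤ B·A_{k₀}`). [cite: Nesterenko2003, §2 p. 56; Matveev2000, (1.3)] -/
theorem coreArch_of_coreW {C : ℕ → ℝ} (hC0 : ∀ r, 0 ≤ C r) (hCmono : Monotone C)
    (h : ∀ r, CoreArchW C r) : ∀ r, CoreArch C r := by
  intro r
  induction r using Nat.strong_induction_on with
  | _ n ih =>
    intro a b A B ha hind hA hA1 hb hB
    by_cases hz : ∃ k, b k = 0
    · obtain ⟨r, θ, m, A', B', D, hr, hθ, hindθ, hA', hA1', hm, hB', hcmp, hcost⟩ :=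
        stepArch_of_exists_eq_zero (hC0 n) (fun r hr => hCmono hr.le) ha hind hA hA1 hb hB hz
      have hIH := ih r hr θ m A' B' hθ hindθ hA' hA1' hm hB'
      linarith
    · push Not at hz
      -- `n ≥ 1` and the pivot `k₀ := argmax A`
      have hne : (Finset.univ : Finset (Fin n)).Nonempty := by
        by_contra h0
        rw [Finset.not_nonempty_iff_eq_empty, Finset.univ_eq_empty_iff] at h0
        exact hb (funext fun j => (IsEmpty.false j).elim)
      obtain ⟨k₀, -, hk₀⟩ := Finset.exists_max_image Finset.univ A hne
      have hB1 : 1 ≤ B := one_le_bound hb hB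
      refine h n a b A B k₀ ha hind hA hA1 (hz k₀) fun j => ?_
      exact mul_le_mul (hB j) (hk₀ j (Finset.mem_univ j)) (by linarith [hA1 j]) (by linarith)

/-- **The route's crux text `ArchCoreRat` from the pivot-weighted internal statement at every rank**, for one
admissible monotone `0 ≤ C r ≤ c₁ʳ`. [cite: Nesterenko2003, Thm 2.2 (p. 55); Matveev2000, Cor 2.3; shape only] -/
theorem archCoreRat_of_coreW {C : ℕ → ℝ} {c₁ : ℝ} (hC : ∀ r, 0 ≤ C r ∧ C r ≤ c₁ ^ r) (hCmono : Monotone C)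
    (hcore : ∀ r, CoreArchW C r) :
    ∃ c : ℝ, ∀ (r : ℕ) (a : Fin r → ℚ) (b : Fin r → ℤ) (A : Fin r → ℝ) (B : ℝ),
      (∀ i, 0 < a i) →
      (∀ μ : Fin r → ℤ, ∏ i, a i ^ μ i = 1 → μ = 0) →
      (∀ i, Height.logHeight₁ (a i) ≤ A i) → (∀ i, 1 ≤ A i) →
      b ≠ 0 → (∀ i, (|b i| : ℝ) ≤ B) →
      -(c ^ r * (∏ i, A i) * Real.log (Real.exp 1 * B)) ≤
        Real.log |∑ i, (b i : ℝ) * Real.log (a i : ℝ)| :=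
  archCoreRat_of_core hC (coreArch_of_coreW (fun r => (hC r).1) hCmono hcore)

/-- The same with the common choice `C r := c ^ r`, `1 ≤ c` (monotone and non-negative automatically).
[cite: Nesterenko2003, Thm 2.2 (p. 55); shape only] -/
theorem archCoreRat_of_coreW_pow {c : ℝ} (hc : 1 ≤ c) (hcore : ∀ r, CoreArchW (fun r => c ^ r) r) :
    ∃ c : ℝ, ∀ (r : ℕ) (a : Fin r → ℚ) (b : Fin r → ℤ) (A : Fin r → ℝ) (B : ℝ),
      (∀ i, 0 < a i) →
      (∀ μ : Fin r → ℤ, ∏ i, a i ^ μ i = 1 → μ = 0) →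
      (∀ i, Height.logHeight₁ (a i) ≤ A i) → (∀ i, 1 ≤ A i) →
      b ≠ 0 → (∀ i, (|b i| : ℝ) ≤ B) →
      -(c ^ r * (∏ i, A i) * Real.log (Real.exp 1 * B)) ≤
        Real.log |∑ i, (b i : ℝ) * Real.log (a i : ℝ)| :=
  archCoreRat_of_coreW (c₁ := c) (fun r => ⟨by positivity, le_rfl⟩)
    (fun r s hrs => pow_le_pow_right₀ hc hrs) hcore

end Summit.ABC.StewartYu.GenThreeInductionArchW

end
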